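import Literature.Analysis.FunctionSpaces.TorusSymbolCalculus
import Literature.Analysis.FunctionSpaces.TorusFourierModes
import Literature.Analysis.FunctionSpaces.TorusSobolevNormFacts
import HarnessLib

/-!
# First-order differential operators with smooth coefficients on `T^d` and their lattice images
# (Warner 6.24–6.25)

Continuation of `TorusSymbolCalculus.lean`. A first-order operator on `V`-valued functions on the
torus with constant principal coefficients `P_j` perturbed by smooth operator-valued functions
`p_j` and with a smooth order-zero coefficient `p₀`,

  `Q g = ∑_j P_j ∂_j g + ∑_j p_j · ∂_j g + p₀ · g`    (`Torus.FOp1`, `Torus.FOp1.apply`),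

is read on the Fourier coefficients by the lattice operator `Lattice.POp1` with the same constant
part and the coefficient families `𝓕p_j`, `𝓕p₀` (`Torus.FOp1.toPOp1`):

  `𝓕(Q g) = Q̂ (𝓕g)`  for smooth `g`   (`Torus.FOp1.mFourierCoeff_apply`),

by the product rule and `𝓕(∂_j g) = ∂_j 𝓕g` of `TorusSymbolCalculus`. Consequently the composite of
two such operators is read by the lattice composition `Lattice.POp1.comp`
(`Torus.FOp1.mFourierCoeff_apply_apply`; Warner 6.24: the product of periodic differential
operators), and the second-order operators `P₁Q₁ + P₂Q₂` met as Laplacians by `Lattice.POp.add`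
(`Torus.mFourierCoeff_laplaceLike`). This is the form in which Warner's periodic elliptic theory
(6.29–6.30, landed on the lattice) is fed from the torus.

## References

* F. W. Warner, *Foundations of Differentiable Manifolds and Lie Groups*, GTM 94 (1983), 6.24,
  6.25. [WarnerGTM94]
-/

noncomputable section

open Set Filter Function MeasureTheory UnitAddTorus Complex
open scoped Topology ContDiff

namespace Literature.Analysis.FunctionSpaces

namespace Torus

open Lattice

variable {d : Type*} [Fintype d] [DecidableEq d]
variable {V W X : Type*} [NormedAddCommGroup V] [NormedSpace ℂ V] [NormedAddCommGroup W]
  [NormedSpace ℂ W] [NormedAddCommGroup X] [NormedSpace ℂ X]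

omit [DecidableEq d] in
/-- Finite sums of smooth functions on the torus are smooth. [folklore] -/
theorem isSmooth_finset_sum {ι : Type*} (F : Finset ι) {f : ι → UnitAddTorus d → W}
    (h : ∀ i ∈ F, IsSmooth (f i)) : IsSmooth (∑ i ∈ F, f i) := by
  classical
  induction F using Finset.induction_on with
  | empty => rw [Finset.sum_empty]; exact isSmooth_const (0 : W)
  | insert i F hi ih =>
      rw [Finset.sum_insert hi]
      exact (h i (Finset.mem_insert_self i F)).add (ih fun j hj => h j (Finset.mem_insert_of_mem hj))

variable (d V W) in
/-- **A first-order differential operator with smooth coefficients on the torus**, in the normal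
form `Q g = ∑_j P_j ∂_j g + ∑_j p_j · ∂_j g + p₀ · g` with constant `P_j` (the frozen principal
coefficients) and smooth operator-valued `p_j`, `p₀` (Warner 6.24 with `l = 1`, the principal part
split as in 6.29). [cite: WarnerGTM94, 6.24] -/
structure FOp1 where
  /-- the frozen (constant) first-order coefficients -/
  P : d → (V →L[ℂ] W)
  /-- the smooth perturbation of the first-order coefficients -/
  p : d → UnitAddTorus d → (V →L[ℂ] W)
  /-- the smooth order-zero coefficient -/
  p0 : UnitAddTorus d → (V →L[ℂ] W)
  /-- smoothness of the perturbation -/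
  hp : ∀ j, IsSmooth (p j)
  /-- smoothness of the order-zero coefficient -/
  hp0 : IsSmooth p0

namespace FOp1

variable (Q : FOp1 d V W)

/-- **The action** `Q g = ∑_j P_j ∂_j g + ∑_j p_j · ∂_j g + p₀ · g` (a sum of three functions,
mirroring `Lattice.POp1.apply`). [cite: WarnerGTM94, 6.24 (2)] -/
def apply (g : UnitAddTorus d → V) : UnitAddTorus d → W :=
  (fun x => ∑ j, Q.P j (Torus.partialDeriv j g x)) + (fun x => ∑ j, Q.p j x (Torus.partialDeriv j g x)) +
    fun x => Q.p0 x (g x)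

/-- Unfolding of `apply`. [folklore] -/
theorem apply_def (g : UnitAddTorus d → V) : Q.apply g =
    (fun x => ∑ j, Q.P j (Torus.partialDeriv j g x)) + (fun x => ∑ j, Q.p j x (Torus.partialDeriv j g x)) +
      fun x => Q.p0 x (g x) := by
  unfold apply
  rfl

/-- `Q g` is smooth for smooth `g`. [folklore] -/
theorem isSmooth_apply {g : UnitAddTorus d → V} (hg : IsSmooth g) : IsSmooth (Q.apply g) := by
  rw [apply_def]
  refine (IsSmooth.add ?_ ?_).add ((Q.hp0).clm_apply hg)
  · have : (fun x => ∑ j, Q.P j (Torus.partialDeriv j g x)) =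
        ∑ j, fun x => Q.P j (Torus.partialDeriv j g x) := by
      funext x; simp [Finset.sum_apply]
    rw [this]
    exact isSmooth_finset_sum _ fun j _ => (isSmooth_const (Q.P j)).clm_apply (hg.partialDeriv j)
  · have : (fun x => ∑ j, Q.p j x (Torus.partialDeriv j g x)) =
        ∑ j, fun x => Q.p j x (Torus.partialDeriv j g x) := by
      funext x; simp [Finset.sum_apply]
    rw [this]
    exact isSmooth_finset_sum _ fun j _ => (Q.hp j).clm_apply (hg.partialDeriv j)

variable [CompleteSpace W]

/-- **The lattice image** `Q̂` of `Q`: the same frozen coefficients, and the Fourier coefficient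
families of `p_j`, `p₀` (rapidly decreasing since these are smooth). [cite: WarnerGTM94, 6.25] -/
def toPOp1 : Lattice.POp1 d V W where
  P := Q.P
  p := fun j => mFourierCoeff (Q.p j)
  p0 := mFourierCoeff Q.p0
  hp := fun j => (Q.hp j).rapidDecay_mFourierCoeff
  hp0 := Q.hp0.rapidDecay_mFourierCoeff

/-- The frozen coefficients of `Q̂`. [folklore] -/
@[simp] theorem toPOp1_P (j : d) : Q.toPOp1.P j = Q.P j := rfl

/-- The perturbation symbols of `Q̂`. [folklore] -/
@[simp] theorem toPOp1_p (j : d) : Q.toPOp1.p j = mFourierCoeff (Q.p j) := rfl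

/-- The order-zero symbol of `Q̂`. [folklore] -/
@[simp] theorem toPOp1_p0 : Q.toPOp1.p0 = mFourierCoeff Q.p0 := rfl

variable [CompleteSpace V]

/-- **`𝓕(Q g) = Q̂ (𝓕g)` for smooth `g`**: a first-order operator with smooth periodic
coefficients acts on the Fourier coefficients by its lattice image (the product rule
`𝓕(p · h) = 𝓕p ⋆ 𝓕h` and `𝓕(∂_j g) = ∂_j 𝓕g`). [cite: WarnerGTM94, 6.25] -/
theorem mFourierCoeff_apply {g : UnitAddTorus d → V} (hg : IsSmooth g) :
    mFourierCoeff (Q.apply g) = Q.toPOp1.apply (mFourierCoeff g) := by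
  have h1 : ∀ j, IsSmooth (Torus.partialDeriv j g) := fun j => hg.partialDeriv j
  have hA : IsSmooth fun x => ∑ j, Q.P j (Torus.partialDeriv j g x) := by
    have : (fun x => ∑ j, Q.P j (Torus.partialDeriv j g x)) = ∑ j, fun x => Q.P j (Torus.partialDeriv j g x) := by
      funext x; simp [Finset.sum_apply]
    rw [this]
    exact isSmooth_finset_sum _ fun j _ => (isSmooth_const (Q.P j)).clm_apply (h1 j)
  have hB : IsSmooth fun x => ∑ j, Q.p j x (Torus.partialDeriv j g x) := by
    have : (fun x => ∑ j, Q.p j x (Torus.partialDeriv j g x)) = ∑ j, fun x => Q.p j x (Torus.partialDeriv j g x) := by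
      funext x; simp [Finset.sum_apply]
    rw [this]
    exact isSmooth_finset_sum _ fun j _ => (Q.hp j).clm_apply (h1 j)
  have hC : IsSmooth fun x => Q.p0 x (g x) := Q.hp0.clm_apply hg
  funext k
  rw [apply_def, Lattice.POp1.apply_def, mFourierCoeff_add (hA.add hB).integrable hC.integrable,
    mFourierCoeff_add hA.integrable hB.integrable,
    mFourierCoeff_finset_sum _ (fun j _ => ((isSmooth_const (Q.P j)).clm_apply (h1 j)).integrable),
    mFourierCoeff_finset_sum _ (fun j _ => ((Q.hp j).clm_apply (h1 j)).integrable)]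
  simp only [Pi.add_apply, Finset.sum_apply, toPOp1_P, toPOp1_p, toPOp1_p0]
  congr 1
  · congr 1
    · refine Finset.sum_congr rfl fun j _ => ?_
      rw [mFourierCoeff_comp_clm (Q.P j) (h1 j).continuous, ← hg.mFourierCoeff_partialDeriv_eq_freqDeriv j]
    · refine Finset.sum_congr rfl fun j _ => ?_
      rw [(Q.hp j).mFourierCoeff_clm_apply (h1 j), hg.mFourierCoeff_partialDeriv_eq_freqDeriv j]
  · exact Q.hp0.mFourierCoeff_clm_apply hg k

/-- **Composites**: `𝓕(P (Q g)) = (P̂ ∘ Q̂)(𝓕g)` for smooth `g` (Warner 6.24: the product of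
periodic differential operators, read on the lattice by `Lattice.POp1.comp`). [cite: WarnerGTM94, 6.24] -/
theorem mFourierCoeff_apply_apply [CompleteSpace X] (P : FOp1 d W X) (Q : FOp1 d V W)
    {g : UnitAddTorus d → V} (hg : IsSmooth g) :
    mFourierCoeff (P.apply (Q.apply g)) = (P.toPOp1.comp Q.toPOp1).apply (mFourierCoeff g) := by
  rw [P.mFourierCoeff_apply (Q.isSmooth_apply hg), Q.mFourierCoeff_apply hg,
    Lattice.POp1.apply_comp _ _ hg.rapidDecay_mFourierCoeff.tempered]

end FOp1

/-! ### Laplace-like operators `P₁Q₁ + P₂Q₂` -/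

section LaplaceLike

variable [CompleteSpace V] [CompleteSpace W] [CompleteSpace X]

/-- **A sum of two composites of first-order operators is read by `POp.add` of the lattice
composites**: for smooth `g`,
`𝓕(P₁(Q₁ g) + P₂(Q₂ g)) = ((P̂₁ ∘ Q̂₁) + (P̂₂ ∘ Q̂₂))(𝓕g)` — the shape `Δ = δd + dδ`,
`Δ_∂̄ = ∂̄*∂̄ + ∂̄∂̄*` of the Laplacians in a chart. [cite: WarnerGTM94, 6.24] -/
theorem mFourierCoeff_laplaceLike {Y : Type*} [NormedAddCommGroup Y] [NormedSpace ℂ Y] [CompleteSpace Y]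
    (P₁ : FOp1 d W X) (Q₁ : FOp1 d V W) (P₂ : FOp1 d Y X) (Q₂ : FOp1 d V Y)
    {g : UnitAddTorus d → V} (hg : IsSmooth g) :
    mFourierCoeff (P₁.apply (Q₁.apply g) + P₂.apply (Q₂.apply g)) =
      ((P₁.toPOp1.comp Q₁.toPOp1).add (P₂.toPOp1.comp Q₂.toPOp1)).apply (mFourierCoeff g) := by
  have ht : Tempered (mFourierCoeff g) := hg.rapidDecay_mFourierCoeff.tempered
  funext k
  rw [mFourierCoeff_add (P₁.isSmooth_apply (Q₁.isSmooth_apply hg)).integrable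
      (P₂.isSmooth_apply (Q₂.isSmooth_apply hg)).integrable,
    Lattice.POp.apply_add_op _ _ ht, Pi.add_apply, ← P₁.mFourierCoeff_apply_apply Q₁ hg,
    ← P₂.mFourierCoeff_apply_apply Q₂ hg]

omit [CompleteSpace V] [CompleteSpace W] [CompleteSpace X] in
/-- The operator value `P₁(Q₁ g) + P₂(Q₂ g)` is smooth for smooth `g`. [folklore] -/
theorem isSmooth_laplaceLike {Y : Type*} [NormedAddCommGroup Y] [NormedSpace ℂ Y]
    (P₁ : FOp1 d W X) (Q₁ : FOp1 d V W) (P₂ : FOp1 d Y X) (Q₂ : FOp1 d V Y)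
    {g : UnitAddTorus d → V} (hg : IsSmooth g) :
    IsSmooth (P₁.apply (Q₁.apply g) + P₂.apply (Q₂.apply g)) :=
  (P₁.isSmooth_apply (Q₁.isSmooth_apply hg)).add (P₂.isSmooth_apply (Q₂.isSmooth_apply hg))

end LaplaceLike

end Torus

end Literature.Analysis.FunctionSpaces
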